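import Mathlib
import Summits.ValiantsHypothesis.ValiantsHypothesis.Theses.CirculantFourier
import Literature.Computability.AlgebraicComplexity.ArithCircuit
import Literature.Barriers.ValiantsHypothesis.MonotoneGap
import HarnessLib

/-!
# Route CirculantFourier — support item `ChargeSliceMonotoneEasy` (stmt-ValiantsHypothesis-6308)

**Claim settled.**
`Summit.ValiantsHypothesis.ValiantsHypothesis.Theses.CirculantFourier.ChargeSliceMonotoneEasy`:
there is an absolute constant `C` (here `C = 2`) such that for every `n ≥ 1` the full charge-`0`
slice polynomial
`S_n := Σ_{s : [n] → [n], Σ_i s_i ≡ 0 (mod n)} Π_i μ_{s_i} ∈ ℝ≥0[μ_0, …, μ_{n-1}]`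
is computed by a plain (all sum coefficients `1`), fan-in-two monotone circuit over `ℝ≥0` of
size `≤ C · n³` — so support / parse-tree counting cannot separate the Fourier form `QF_n` of the
circulant permanent (whose support lies in this slice) from easy polynomials.

## Proof (dynamic programming over residues = iterated cyclic convolution)

For `k = 0, …, n` and a residue `r : Fin n` put
`D(k, r) := Σ_{s : Fin k → Fin n, Σ_i s_i = r in Fin n} Π_i X_{s_i}`, so that
`D(0, r) = [r = 0]` (`slice_zero`), `D(k+1, r) = Σ_j X_j · D(k, r - j)` (`slice_succ`: split off
`s 0` along `Fin.consEquiv`), and `D(n, 0) = S_n` (`slice_eq`: the value of a sum in `Fin n` is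
the sum of the values modulo `n`). The circuit has `n` levels; level `k+1` consists of `n` blocks
(one per residue `r`), each block being `n` product gates `X_j · D(k, r-j)` interleaved with `n`
plain binary additions accumulating them onto the constant `0`: `2n` gates per block, `2n²` per
level, `2n³` in all, every gate binary and plain. The semantics is carried by *stable
denotation* `∀ ws, u.eval (gateValues gs ++ ws) = p` ("the operand `u` reads the value `p`
against the value list of the gate list `gs`, however `gs` is extended"), which is monotone under
appending gates (`denotes_mono`) and holds for the reference to a freshly appended binary gate
given the denotations of its operands (`denotes_add`, `denotes_mul`); the three layers (one
block `exists_block`, one level `exists_level`, all levels `exists_levels`) are existence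
statements proved by list / nat induction, so no auxiliary definition is introduced.

Unconditional: no named fact is assumed (axioms `propext`, `Classical.choice`, `Quot.sound`).

## References

* [JerrumSnir1982] M. Jerrum, M. Snir, *Some exact complexity results for straight-line
  computations over semirings*, J. ACM 29 (1982), §2.1–2.2 (the monotone model).
* [BurgisserClausenShokrollahi1997] P. Bürgisser, M. Clausen, M. A. Shokrollahi, *Algebraic
  Complexity Theory*, Springer 1997, Ch. 21 (straight-line programs), §2.1 (cyclic
  convolution).
-/

noncomputable section

-- `Summit.ValiantsHypothesis.ValiantsHypothesis.…` is the tree's mandated single-conjunct layout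
-- (Sub = Summit), so the duplicated namespace component is intended.
set_option linter.dupNamespace false

namespace Summit.ValiantsHypothesis.ValiantsHypothesis.Theorems.CirculantFourierChargeSliceMonotoneEasy

open MvPolynomial Literature.Computability.AlgebraicComplexity
  Literature.Computability.AlgebraicComplexity.ArithCircuit Literature.Barriers.ValiantsHypothesis

open scoped NNReal

universe u v

/-! ### Stable denotation of operands; one accumulation block -/

section Block

variable {k : Type u} {σ : Type v} [CommSemiring k]

/-- The value list of an extended gate list extends the value list. [folklore] -/
theorem exists_gateValues_append (gs gs' : List (Gate k σ)) :
    ∃ extra, gateValues (gs ++ gs') = gateValues gs ++ extra := by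
  induction gs' using List.reverseRecOn with
  | nil => exact ⟨[], by simp⟩
  | append_singleton gs' g ih =>
    obtain ⟨extra, h⟩ := ih
    refine ⟨extra ++ [g.eval (gateValues (gs ++ gs'))], ?_⟩
    rw [← List.append_assoc, gateValues_append_singleton, h, List.append_assoc]

/-- Stable denotation (`u` reads `p` against the values of `gs`, however extended) is preserved
when gates are appended. [folklore] -/
theorem denotes_mono {gs : List (Gate k σ)} {u : Operand k σ} {p : MvPolynomial σ k}
    (h : ∀ ws, u.eval (gateValues gs ++ ws) = p) (gs' : List (Gate k σ)) :
    ∀ ws, u.eval (gateValues (gs ++ gs') ++ ws) = p := by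
  intro ws
  obtain ⟨extra, he⟩ := exists_gateValues_append gs gs'
  rw [he, List.append_assoc]
  exact h _

/-- A stably denoting operand evaluates to its denotation against the bare value list.
[folklore] -/
theorem denotes_eval_eq {gs : List (Gate k σ)} {u : Operand k σ} {p : MvPolynomial σ k}
    (h : ∀ ws, u.eval (gateValues gs ++ ws) = p) : u.eval (gateValues gs) = p := by
  simpa using h []

/-- The reference to a freshly appended gate reads that gate's value, whatever comes after.
[folklore] -/
theorem eval_gate_length (gs : List (Gate k σ)) (g : Gate k σ) (ws : List (MvPolynomial σ k)) :
    (Operand.gate gs.length : Operand k σ).eval (gateValues (gs ++ [g]) ++ ws) =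
      g.eval (gateValues gs) := by
  rw [gateValues_append_singleton, List.append_assoc, Operand.eval_gate,
    List.getD_eq_getElem?_getD, List.getElem?_append_right (by simp), gateValues_length,
    Nat.sub_self]
  simp

/-- Appending the plain binary sum gate `u + v` yields a reference stably denoting `p + q`.
[folklore] -/
theorem denotes_add {gs : List (Gate k σ)} {u v : Operand k σ} {p q : MvPolynomial σ k}
    (hu : ∀ ws, u.eval (gateValues gs ++ ws) = p) (hv : ∀ ws, v.eval (gateValues gs ++ ws) = q) :
    ∀ ws, (Operand.gate gs.length : Operand k σ).eval
      (gateValues (gs ++ [Gate.sum [(1, u), (1, v)]]) ++ ws) = p + q := by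
  intro ws
  rw [eval_gate_length]
  simp [Gate.eval, denotes_eval_eq hu, denotes_eval_eq hv]

/-- Appending the binary product gate `u * v` yields a reference stably denoting `p * q`.
[folklore] -/
theorem denotes_mul {gs : List (Gate k σ)} {u v : Operand k σ} {p q : MvPolynomial σ k}
    (hu : ∀ ws, u.eval (gateValues gs ++ ws) = p) (hv : ∀ ws, v.eval (gateValues gs ++ ws) = q) :
    ∀ ws, (Operand.gate gs.length : Operand k σ).eval
      (gateValues (gs ++ [Gate.prod [u, v]]) ++ ws) = p * q := by
  intro ws
  rw [eval_gate_length]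
  simp [Gate.eval, denotes_eval_eq hu, denotes_eval_eq hv]

/-- The plain binary sum gate is binary and plain. [folklore] -/
theorem good_sum (u v : Operand k σ) :
    (Gate.sum [(1, u), (1, v)] : Gate k σ).fanIn ≤ 2 ∧
      IsPlainGate (Gate.sum [(1, u), (1, v)] : Gate k σ) :=
  ⟨by simp [Gate.fanIn, Gate.args], by simp [IsPlainGate]⟩

/-- The binary product gate is binary and plain. [folklore] -/
theorem good_prod (u v : Operand k σ) :
    (Gate.prod [u, v] : Gate k σ).fanIn ≤ 2 ∧ IsPlainGate (Gate.prod [u, v] : Gate k σ) :=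
  ⟨by simp [Gate.fanIn, Gate.args], isPlainGate_prod _⟩

/-- **One block.** Given gates `gs`, an accumulator operand stably denoting `a` and terms
`(i, u)` whose operands stably denote `q u`, appending, for each term in turn, the product gate
`X i * u` and a plain sum gate adding it to the running accumulator yields `2 · |terms|` binary
plain gates whose last sum gate stably denotes `a + Σ_{(i,u)} X_i · q u`. [folklore] -/
theorem exists_block (terms : List (σ × Operand k σ)) :
    ∀ (gs : List (Gate k σ)) (acc : Operand k σ) (a : MvPolynomial σ k)
      (q : Operand k σ → MvPolynomial σ k),
      (∀ ws, acc.eval (gateValues gs ++ ws) = a) →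
      (∀ t ∈ terms, ∀ ws, (t.2).eval (gateValues gs ++ ws) = q t.2) →
      ∃ (blk : List (Gate k σ)) (out : Operand k σ), blk.length = 2 * terms.length ∧
        (∀ g ∈ blk, g.fanIn ≤ 2 ∧ IsPlainGate g) ∧
        ∀ ws, out.eval (gateValues (gs ++ blk) ++ ws) =
          a + (terms.map fun t => X t.1 * q t.2).sum := by
  induction terms with
  | nil =>
    intro gs acc a q ha _
    exact ⟨[], acc, rfl, fun g hg => by simp at hg, by simpa using ha⟩
  | cons t rest ih =>
    intro gs acc a q ha hq
    have h1 : ∀ ws, (Operand.gate gs.length : Operand k σ).eval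
        (gateValues (gs ++ [Gate.prod [.var t.1, t.2]]) ++ ws) = X t.1 * q t.2 :=
      denotes_mul (fun _ => rfl) (hq t (by simp))
    have h2 : ∀ ws, (Operand.gate (gs.length + 1) : Operand k σ).eval (gateValues
        (gs ++ [Gate.prod [.var t.1, t.2], Gate.sum [(1, acc), (1, .gate gs.length)]]) ++ ws)
          = a + X t.1 * q t.2 := by
      have h := denotes_add (denotes_mono ha [Gate.prod [.var t.1, t.2]]) h1
      simpa [List.append_assoc] using h
    have h3 : ∀ t' ∈ rest, ∀ ws, (t'.2).eval (gateValues
        (gs ++ [Gate.prod [.var t.1, t.2], Gate.sum [(1, acc), (1, .gate gs.length)]]) ++ ws)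
          = q t'.2 :=
      fun t' ht' => denotes_mono (hq t' (by simp [ht'])) _
    obtain ⟨blk, out, hlen, hgood, hout⟩ := ih _ _ _ q h2 h3
    refine ⟨Gate.prod [.var t.1, t.2] :: Gate.sum [(1, acc), (1, .gate gs.length)] :: blk, out,
      ?_, ?_, ?_⟩
    · simp only [List.length_cons, hlen]
      ring
    · intro g hg
      simp only [List.mem_cons] at hg
      rcases hg with rfl | rfl | hg
      · exact good_prod _ _
      · exact good_sum _ _
      · exact hgood g hg
    · intro ws
      have h := hout ws
      simp only [List.append_assoc, List.cons_append, List.nil_append] at h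
      simp only [List.map_cons, List.sum_cons, ← add_assoc]
      exact h

end Block

/-! ### One level, all levels, the closed form, and the item -/

section Main

variable {k : Type u} [CommSemiring k] {n : ℕ}

/-- **One level.** Given gates `gs` and operands `ops r` stably denoting `D r` for every residue
`r`, appending one block per residue `r ∈ rs` (terms `X_j · D(r - j)`, `j = 0, …, n-1`,
accumulated onto the constant `0`) yields `|rs| · 2n` binary plain gates and operands stably
denoting `Σ_j X_j · D(r - j)` for every `r ∈ rs`. [folklore] -/
theorem exists_level (ops : Fin n → Operand k (Fin n)) (D : Fin n → MvPolynomial (Fin n) k)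
    (rs : List (Fin n)) : ∀ gs : List (Gate k (Fin n)),
      (∀ r ws, (ops r).eval (gateValues gs ++ ws) = D r) →
      ∃ (lg : List (Gate k (Fin n))) (ops' : Fin n → Operand k (Fin n)),
        lg.length = rs.length * (2 * n) ∧ (∀ g ∈ lg, g.fanIn ≤ 2 ∧ IsPlainGate g) ∧
        ∀ r ∈ rs, ∀ ws, (ops' r).eval (gateValues (gs ++ lg) ++ ws) =
          ∑ j : Fin n, X j * D (r - j) := by
  induction rs with
  | nil =>
    intro gs _
    exact ⟨[], ops, by simp, fun g hg => by simp at hg, fun r hr => by simp at hr⟩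
  | cons r rs ih =>
    intro gs hops
    obtain ⟨blk, out, hlen, hgood, hout⟩ :=
      exists_block ((List.finRange n).map fun j => (j, ops (r - j))) gs (.const 0) (C 0)
        (fun u => u.eval (gateValues gs)) (fun _ => rfl) (by
          intro t ht
          simp only [List.mem_map, List.mem_finRange, true_and] at ht
          obtain ⟨j, rfl⟩ := ht
          intro ws
          rw [denotes_eval_eq (hops (r - j))]
          exact hops (r - j) ws)
    have hout' : ∀ ws, out.eval (gateValues (gs ++ blk) ++ ws) = ∑ j : Fin n, X j * D (r - j) := by
      intro ws
      rw [hout ws]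
      simp only [C_0, zero_add, List.map_map, Fin.sum_univ_def]
      refine congrArg List.sum (List.map_congr_left fun j _ => ?_)
      simp only [Function.comp_apply, denotes_eval_eq (hops (r - j))]
    obtain ⟨lg, ops', hlen', hgood', hops'⟩ :=
      ih (gs ++ blk) (fun r' => denotes_mono (hops r') blk)
    refine ⟨blk ++ lg, fun r' => if r' = r then out else ops' r', ?_, ?_, ?_⟩
    · simp only [List.length_append, hlen, hlen', List.length_map, List.length_finRange,
        List.length_cons]
      ring
    · intro g hg
      rcases List.mem_append.mp hg with hg | hg
      · exact hgood g hg
      · exact hgood' g hg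
    · intro r' hr' ws
      rw [← List.append_assoc]
      dsimp only
      by_cases h : r' = r
      · subst h
        rw [if_pos rfl]
        exact denotes_mono hout' lg ws
      · rw [if_neg h]
        have hr'' : r' ∈ rs := by simpa [h] using hr'
        exact hops' r' hr'' ws

/-- The value of a sum in `Fin n` is the sum of the values modulo `n`. [folklore] -/
theorem val_finset_sum_mod [NeZero n] {ι : Type*} (t : Finset ι) (s : ι → Fin n) :
    ((∑ i ∈ t, s i : Fin n) : ℕ) = (∑ i ∈ t, (s i : ℕ)) % n := by
  classical
  induction t using Finset.induction_on with
  | empty => simp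
  | insert a t ha ih =>
    rw [Finset.sum_insert ha, Finset.sum_insert ha, Fin.val_add, ih, Nat.add_mod_mod]

/-- Level `0` of the programme: `D(0, r) = [r = 0]`, a constant. [folklore] -/
theorem slice_zero [NeZero n] (r : Fin n) :
    (∑ s : Fin 0 → Fin n, if (∑ i, s i) = r then ∏ i, X (s i) else 0 : MvPolynomial (Fin n) k) =
      C (if r = 0 then 1 else 0) := by
  rw [Fintype.sum_unique]
  simp only [Finset.univ_eq_empty, Finset.sum_empty, Finset.prod_empty]
  by_cases hr : r = 0
  · subst hr
    simp
  · simp [hr, Ne.symm hr]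

/-- The recurrence `D(k+1, r) = Σ_j X_j · D(k, r - j)` (split off `s 0`). [folklore] -/
theorem slice_succ [NeZero n] (lvl : ℕ) (r : Fin n) :
    (∑ s : Fin (lvl + 1) → Fin n, if (∑ i, s i) = r then ∏ i, X (s i) else 0 :
        MvPolynomial (Fin n) k) =
      ∑ j : Fin n, X j * ∑ s : Fin lvl → Fin n, if (∑ i, s i) = r - j then ∏ i, X (s i) else 0 := by
  rw [← (Fin.consEquiv fun _ => Fin n).sum_comp, Fintype.sum_prod_type]
  refine Finset.sum_congr rfl fun j _ => ?_
  rw [Finset.mul_sum]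
  refine Finset.sum_congr rfl fun s _ => ?_
  simp only [Fin.consEquiv_apply, Fin.sum_univ_succ, Fin.prod_univ_succ, Fin.cons_zero,
    Fin.cons_succ, mul_ite, mul_zero, eq_sub_iff_add_eq']

/-- **All levels.** For every `lvl` there are `lvl · 2n²` binary plain gates and operands
`ops r` stably denoting `D(lvl, r) = Σ_{s : Fin lvl → Fin n, Σ s_i = r} Π X_{s_i}` for every
residue `r` (level `0`: the constants `[r = 0]`; level `lvl + 1`: `exists_level` on level `lvl`,
by `slice_succ`). [folklore] -/
theorem exists_levels [NeZero n] (lvl : ℕ) :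
    ∃ (gs : List (Gate k (Fin n))) (ops : Fin n → Operand k (Fin n)),
      gs.length = lvl * (2 * n * n) ∧ (∀ g ∈ gs, g.fanIn ≤ 2 ∧ IsPlainGate g) ∧
      ∀ r ws, (ops r).eval (gateValues gs ++ ws) =
        ∑ s : Fin lvl → Fin n, if (∑ i, s i) = r then ∏ i, X (s i) else 0 := by
  induction lvl with
  | zero =>
    refine ⟨[], fun r => .const (if r = 0 then 1 else 0), by simp, fun g hg => by simp at hg, ?_⟩
    intro r ws
    rw [slice_zero]
    rfl
  | succ lvl ih =>
    obtain ⟨gs, ops, hlen, hgood, hops⟩ := ih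
    obtain ⟨lg, ops', hlen', hgood', hops'⟩ := exists_level ops _ (List.finRange n) gs hops
    refine ⟨gs ++ lg, ops', ?_, ?_, ?_⟩
    · rw [List.length_append, hlen, hlen', List.length_finRange]
      ring
    · intro g hg
      rcases List.mem_append.mp hg with hg | hg
      · exact hgood g hg
      · exact hgood' g hg
    · intro r ws
      rw [hops' r (List.mem_finRange r) ws, slice_succ]

/-- The item's inline polynomial (the charge-`0` slice, condition `Σ_i s_i % n = 0` in `ℕ`) is
`D(n, 0)` (condition `Σ_i s_i = 0` in `Fin n`). [folklore] -/
theorem slice_eq (n : ℕ) [NeZero n] :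
    (∑ s : Fin n → Fin n, (if (∑ i : Fin n, ((s i : Fin n) : ℕ)) % n = 0 then
      ∏ i : Fin n, MvPolynomial.X (s i) else 0 : MvPolynomial (Fin n) ℝ≥0)) =
      ∑ s : Fin n → Fin n, if (∑ i, s i) = 0 then ∏ i, X (s i) else 0 := by
  refine Finset.sum_congr rfl fun s _ => if_congr ?_ rfl rfl
  rw [← val_finset_sum_mod, Fin.val_eq_zero_iff]

/-- **Item `ChargeSliceMonotoneEasy` (stmt-ValiantsHypothesis-6308).** The full charge-`0` slice
polynomial `Σ_{s : [n] → [n], Σ s_i ≡ 0 (n)} Π_i μ_{s_i}` has plain fan-in-two monotone circuits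
over `ℝ≥0` of size `≤ 2 n³` for every `n ≥ 1` (the `n`-level dynamic programme of
`exists_levels`, output = the level-`n` operand of residue `0`). [folklore] -/
theorem chargeSliceMonotoneEasy_proof :
    Summit.ValiantsHypothesis.ValiantsHypothesis.Theses.CirculantFourier.ChargeSliceMonotoneEasy := by
  unfold Summit.ValiantsHypothesis.ValiantsHypothesis.Theses.CirculantFourier.ChargeSliceMonotoneEasy
  refine ⟨2, fun n hn => ?_⟩
  haveI : NeZero n := ⟨by omega⟩
  obtain ⟨gs, ops, hlen, hgood, hops⟩ := exists_levels (k := ℝ≥0) (n := n) n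
  refine ⟨⟨gs, ops 0⟩, ⟨fun g hg => (hgood g hg).1, fun g hg => (hgood g hg).2, ?_⟩, ?_⟩
  · show (ops 0).eval (gateValues gs) = _
    rw [denotes_eval_eq (hops 0), slice_eq]
  · show gs.length ≤ 2 * n ^ 3
    rw [hlen]
    exact le_of_eq (by ring)

end Main

end Summit.ValiantsHypothesis.ValiantsHypothesis.Theorems.CirculantFourierChargeSliceMonotoneEasy
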